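import Summits.QuantumFields.BalabanUV.Beta.D1BFx.RestKernelSlotRowsTwo

/-!
# `BalabanUV.Beta.D1BFx.RestKernelSlotRowsOn` — road «BF-x» for binder row D1, slot (K): **«SLOT PACK ROWS PER SCALE» — THE SANDWICH AND BLOCK SLOT
# PACKs' ROWS WITH THE n-FREE CONSTANTS CHOSEN FIRST AND THE JET LETTERS SUPPLIED SCALE BY SCALE, AND THEIR END SHAPES ON THE END's
# SUBSEQUENCE OF BLOCK SIZES `n = Lc^k`, `k ≥ 1`** (OWNER W-d1p2-g19-11 ∕ RULING ρ-g19-2 «THE END's CURRENCY IS THE SUBSEQUENCE»: PART 14 displays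
# every lane letter as `∀ k, 1 ≤ k → (letter at block size Lc^k)`; `RestKernelSandwichSlot.exists_rows_RkSand` (p324769) ∕ `RestKernelBlockSlot.exists_rows_RkBlk`
# (p325854) take the letters at EVERY block size, `RestKernelSlotRowsTwo` at every block size `≥ 2` — this file takes them on ANY set of scales).

HONEST DEPENDENCY (cell records, verbatim): «continuum YM on T⁴ ⇐ BetaPertH ∧ nine spine estimates (0/9 proved); BetaPertH ⇐ (D1) ∧ (D4) ∧
CAP+tail; G-an2-4 gates asym, D1 and NE2/3/4.»  HONEST FRAMING (cell contract, verbatim): «discharging `BetaPertH` makes Bałaban's UV stability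
UNCONDITIONAL — a real constructive-QFT result; it is NOT the continuum limit and NOT the Clay problem.»  THIS MODULE DISCHARGES NOTHING of the
wall: [folklore] bookkeeping — the landed `exists_rows_*` applied ONCE to the per-scale jets TRUNCATED TO `0` AT EVERY SCALE WHERE THE LETTER IS NOT
SUPPLIED (classical `if`), so the n-free constants `kG K c` come out BEFORE the scale and the letters; the members at a supplied scale do not see the
truncation (`RkSand_congr` ∕ `RkBlk_congr`).  Modulo the displayed [B5] hypotheses `h12` ∕ `h126`; the jet letters are HYPOTHESES per scale, their
uniformity at the road's dressed packs an OPEN (K) estimate, NOT claimed here.  No definition, no `def … : Prop`, no notation, nothing cited, 0 sorry.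
0 root-level binders of row D1 discharged (hW ∕ hR-sockets ∕ hSX-socket ∕ D1Tel ∕ D1Rep — 0); (K) NOT closed; NOT D1, NOT `BetaPertH`, NOT continuum, NOT Clay.

ABSOLUTE RULE (cell charter, verbatim): «No internally-minted statement may enter as a cited fact. Every hypothesis is either kernel-proved in
this package or a verbatim quotation of a PUBLISHED theorem with page reference. The manuscript(s) under audit are NOT citable for their own
disputed steps — they are the thing under adjudication; programme-internal (2001/route/tribunal) claims are never citable.»

CONTENT (all [folklore]).
* §1 **`exists_rows_RkSand_on (P : ℕ → Prop)`**: letters under `P m` (block size `m+1`), `0 ≤ mV`, `0 ≤ mW` displayed ⟹ ONE n-free `kG K c` and the rows at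
  every `m` with `P m`; **`exists_rows_RkSand_at`** (the OWNER's per-scale primitive): `∃ kG K c, … ∧ ∀ m, (the four letters at m) → ∀ u, rows at m+1` —
  no nonnegativity displayed (read off the letters when some scale carries them; vacuous otherwise).
* §2 **`exists_rows_RkBlk_on`**, **`exists_rows_RkBlk_at`**: the same for the block pack.
* §3 **`exists_END_rows_RkSand_pow`** ∕ **`exists_END_rows_RkBlk_pow`** (`[NeZero Lc]`): letters `∀ k, 1 ≤ k → (letter at block size Lc^k)` ⟹ the END's
  (i) `hMR` and (ii) READING (b) `hRu` (`Ru := 0`) at every `Lc^k`, `k ≥ 1`, + the unit row there (§1∕§2 at `P m := ∃ k, 1 ≤ k ∧ m + 1 = Lc^k`).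
NOT HERE (honest): any discharge of a letter; the comb-FP ∕ ghost lanes; `hptw`; `TshotOf`.  Unit `b2b-balaban-beta-d1-formalise-leaf-01` (gen 24), D1 formalisation
swarm leaf prover 01, road «BF-x»; INTENT «SLOT PACK ROWS PER SCALE» (journal; OWNER W-11).
-/

noncomputable section

open Finset
open scoped BigOperators
open Literature.MathematicalPhysics.QuantumFieldTheory.Balaban1983to89
open Literature.MathematicalPhysics.QuantumFieldTheory.Balaban1983to89.Beta
open B12Sec2to5 (l1 l1_nonneg)
open DecimatedMomentSummable (AbsMoment₂)
open ExpKernelCalculus (Site MKer)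
open OneStepResolventKernel (Fib)
open VectorTailsLoc (fam kfam)
open Summit.QuantumFields.BalabanUV.Beta.D1BFx.PackedKernelSplit (blk ffV ffW)
open Summit.QuantumFields.BalabanUV.Beta.D1BFx.FrozenLegTails (nOf MOf hn1)
open Summit.QuantumFields.BalabanUV.Beta.D1BFx.RestKernelSandwichSlot (RkSand CUsand exists_rows_RkSand)
open Summit.QuantumFields.BalabanUV.Beta.D1BFx.RestKernelBlockSlot (RkBlk CUblk exists_rows_RkBlk)
open Summit.QuantumFields.BalabanUV.Beta.D1BFx.RestKernelSlotRowsTwo (ffV_zero_apply ffW_zero_apply blk_zero_apply₂ mass_zero_integrand RkSand_congr RkBlk_congr)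

namespace Summit.QuantumFields.BalabanUV.Beta.D1BFx.RestKernelSlotRowsOn

/-! ## §1 The sandwich pack: letters on a set of scales; per scale -/

section Sand

variable {a : ℝ} (ha : 0 < a) {𝒱 : ℕ → Fin 4 → Site 4 → MKer 4 (Fib 3)} {𝒲 : ℕ → Fin 4 → Site 4 → Fin 4 → Site 4 → MKer 4 (Fib 3)}
  {σV mV κ mW : ℝ} {μ ν : Fin 4}
include ha

/-- [folklore] **THE SANDWICH PACK's ROWS ON A SET OF SCALES**: for any `P : ℕ → Prop`, if the ff jet letters hold at every block size `m + 1` with `P m`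
(and `0 ≤ mV`, `0 ≤ mW` — automatic when some scale carries the letters), there is ONE n-free `kG, K ≥ 0`, `c > 0` with `AbsMoment₂ (RkSand a 𝒱 𝒲 u (m+1) μ ν)`
and `|secondMoment (RkSand a 𝒱 𝒲 u (m+1)) μ ν| ≤ CUsand kG K c σV mV κ mW u` at every such `m` (mod [B5] BY NAME) — `exists_rows_RkSand` at the jets truncated
to `0` off `P`. -/
theorem exists_rows_RkSand_on (P : ℕ → Prop) (h12 : B5.Prop12Printed (fam nOf hn1 MOf a ha)) (h126 : B5.Kernel126_127Printed (kfam nOf MOf))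
    (hσV : 0 < σV) (hmV : 0 ≤ mV) (hκ : 0 < κ) (hmW : 0 ≤ mW)
    (hVs : ∀ (m : ℕ), P m → ∀ (ρ : Fin 4) (y : Site 4), Summable fun p : Site 4 × Site 4 => ∑ g, ∑ f, |ffV (𝒱 (m + 1)) ρ y p.1 p.2 g f|
      * Real.exp (σV / ((m + 1 : ℕ) : ℝ) * (l1 (p.1 - ((m + 1 : ℕ) : ℤ) • y) + l1 (p.2 - ((m + 1 : ℕ) : ℤ) • y))))
    (hVm : ∀ (m : ℕ), P m → ∀ (ρ : Fin 4) (y : Site 4), ∑' p : Site 4 × Site 4, ∑ g, ∑ f, |ffV (𝒱 (m + 1)) ρ y p.1 p.2 g f|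
      * Real.exp (σV / ((m + 1 : ℕ) : ℝ) * (l1 (p.1 - ((m + 1 : ℕ) : ℤ) • y) + l1 (p.2 - ((m + 1 : ℕ) : ℤ) • y))) ≤ mV)
    (hWs : ∀ (m : ℕ), P m → ∀ (z : Site 4), Summable fun p : Site 4 × Site 4 => ∑ g, ∑ f, |ffW (𝒲 (m + 1)) μ 0 ν z p.1 p.2 g f|)
    (hWm : ∀ (m : ℕ), P m → ∀ (z : Site 4),
      ∑' p : Site 4 × Site 4, ∑ g, ∑ f, |ffW (𝒲 (m + 1)) μ 0 ν z p.1 p.2 g f| ≤ mW * Real.exp (-κ * l1 z)) :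
    ∃ kG K c : ℝ, 0 < c ∧ 0 ≤ kG ∧ 0 ≤ K ∧ ∀ (u : Unit ⊕ (Bool × Bool)) (m : ℕ), P m →
      AbsMoment₂ (RkSand a 𝒱 𝒲 u (m + 1) μ ν) ∧ |B12Beta.secondMoment (RkSand a 𝒱 𝒲 u (m + 1)) μ ν| ≤ CUsand kG K c σV mV κ mW u := by
  classical
  have key := exists_rows_RkSand (𝒱 := fun n => if P (n - 1) then 𝒱 n else 0) (𝒲 := fun n => if P (n - 1) then 𝒲 n else 0)
    (mV := mV) (mW := mW) (μ := μ) (ν := ν) ha h12 h126 hσV ?_ ?_ hκ ?_ ?_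
  · obtain ⟨kG, K, c, hc, hkG, hK, hrows⟩ := key
    refine ⟨kG, K, c, hc, hkG, hK, fun u m hm => ?_⟩
    rw [← RkSand_congr a (𝒱 := 𝒱) (𝒲 := 𝒲) (𝒱' := fun n => if P (n - 1) then 𝒱 n else 0) (𝒲' := fun n => if P (n - 1) then 𝒲 n else 0)
      (show (if P (m + 1 - 1) then 𝒱 (m + 1) else 0) = 𝒱 (m + 1) by rw [Nat.add_sub_cancel, if_pos hm])
      (show (if P (m + 1 - 1) then 𝒲 (m + 1) else 0) = 𝒲 (m + 1) by rw [Nat.add_sub_cancel, if_pos hm]) u]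
    exact hrows u (m + 1) (Nat.succ_le_succ (Nat.zero_le m))
  · intro m ρ y
    by_cases hm : P m
    · simp only [Nat.add_sub_cancel, if_pos hm]
      exact hVs m hm ρ y
    · simp only [Nat.add_sub_cancel, if_neg hm]
      rw [mass_zero_integrand (fun x z g f => ffV_zero_apply ρ y x z g f)]
      exact summable_zero
  · intro m ρ y
    by_cases hm : P m
    · simp only [Nat.add_sub_cancel, if_pos hm]
      exact hVm m hm ρ y
    · simp only [Nat.add_sub_cancel, if_neg hm]
      rw [mass_zero_integrand (fun x z g f => ffV_zero_apply ρ y x z g f), tsum_zero]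
      exact hmV
  · intro m z
    by_cases hm : P m
    · simp only [Nat.add_sub_cancel, if_pos hm]
      exact hWs m hm z
    · simp only [Nat.add_sub_cancel, if_neg hm]
      have e := mass_zero_integrand (fun x z' g f => ffW_zero_apply μ 0 ν z x z' g f) (fun _ => (1 : ℝ))
      simp only [mul_one] at e
      rw [e]
      exact summable_zero
  · intro m z
    by_cases hm : P m
    · simp only [Nat.add_sub_cancel, if_pos hm]
      exact hWm m hm z
    · simp only [Nat.add_sub_cancel, if_neg hm]
      have e := mass_zero_integrand (fun x z' g f => ffW_zero_apply μ 0 ν z x z' g f) (fun _ => (1 : ℝ))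
      simp only [mul_one] at e
      rw [e, tsum_zero]
      exact mul_nonneg hmW (Real.exp_pos _).le

/-- [folklore] **THE SANDWICH PACK's ROWS, PER SCALE** (OWNER W-11's primitive): ONE n-free `kG, K ≥ 0`, `c > 0` (chosen before the scale) such that AT
EVERY `m`, the four ff jet letters AT THIS `m` imply the rows of every member at block size `m + 1`.  No nonnegativity displayed: it is read off the
letters of any scale that carries them (and the statement is vacuous if none does). -/
theorem exists_rows_RkSand_at (h12 : B5.Prop12Printed (fam nOf hn1 MOf a ha)) (h126 : B5.Kernel126_127Printed (kfam nOf MOf))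
    (hσV : 0 < σV) (hκ : 0 < κ) :
    ∃ kG K c : ℝ, 0 < c ∧ 0 ≤ kG ∧ 0 ≤ K ∧ ∀ (m : ℕ),
      (∀ (ρ : Fin 4) (y : Site 4), Summable fun p : Site 4 × Site 4 => ∑ g, ∑ f, |ffV (𝒱 (m + 1)) ρ y p.1 p.2 g f|
        * Real.exp (σV / ((m + 1 : ℕ) : ℝ) * (l1 (p.1 - ((m + 1 : ℕ) : ℤ) • y) + l1 (p.2 - ((m + 1 : ℕ) : ℤ) • y)))) →
      (∀ (ρ : Fin 4) (y : Site 4), ∑' p : Site 4 × Site 4, ∑ g, ∑ f, |ffV (𝒱 (m + 1)) ρ y p.1 p.2 g f|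
        * Real.exp (σV / ((m + 1 : ℕ) : ℝ) * (l1 (p.1 - ((m + 1 : ℕ) : ℤ) • y) + l1 (p.2 - ((m + 1 : ℕ) : ℤ) • y))) ≤ mV) →
      (∀ (z : Site 4), Summable fun p : Site 4 × Site 4 => ∑ g, ∑ f, |ffW (𝒲 (m + 1)) μ 0 ν z p.1 p.2 g f|) →
      (∀ (z : Site 4), ∑' p : Site 4 × Site 4, ∑ g, ∑ f, |ffW (𝒲 (m + 1)) μ 0 ν z p.1 p.2 g f| ≤ mW * Real.exp (-κ * l1 z)) →
      ∀ (u : Unit ⊕ (Bool × Bool)),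
        AbsMoment₂ (RkSand a 𝒱 𝒲 u (m + 1) μ ν) ∧ |B12Beta.secondMoment (RkSand a 𝒱 𝒲 u (m + 1)) μ ν| ≤ CUsand kG K c σV mV κ mW u := by
  by_cases hex : ∃ m : ℕ,
      (∀ (ρ : Fin 4) (y : Site 4), Summable fun p : Site 4 × Site 4 => ∑ g, ∑ f, |ffV (𝒱 (m + 1)) ρ y p.1 p.2 g f|
        * Real.exp (σV / ((m + 1 : ℕ) : ℝ) * (l1 (p.1 - ((m + 1 : ℕ) : ℤ) • y) + l1 (p.2 - ((m + 1 : ℕ) : ℤ) • y)))) ∧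
      (∀ (ρ : Fin 4) (y : Site 4), ∑' p : Site 4 × Site 4, ∑ g, ∑ f, |ffV (𝒱 (m + 1)) ρ y p.1 p.2 g f|
        * Real.exp (σV / ((m + 1 : ℕ) : ℝ) * (l1 (p.1 - ((m + 1 : ℕ) : ℤ) • y) + l1 (p.2 - ((m + 1 : ℕ) : ℤ) • y))) ≤ mV) ∧
      (∀ (z : Site 4), Summable fun p : Site 4 × Site 4 => ∑ g, ∑ f, |ffW (𝒲 (m + 1)) μ 0 ν z p.1 p.2 g f|) ∧
      (∀ (z : Site 4), ∑' p : Site 4 × Site 4, ∑ g, ∑ f, |ffW (𝒲 (m + 1)) μ 0 ν z p.1 p.2 g f| ≤ mW * Real.exp (-κ * l1 z))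
  · obtain ⟨m₀, h1, h2, -, h4⟩ := hex
    have hmV : 0 ≤ mV :=
      (tsum_nonneg fun p => Finset.sum_nonneg fun g _ => Finset.sum_nonneg fun f _ => by positivity).trans (h2 0 0)
    have hmW : 0 ≤ mW := by
      have h := h4 0
      have e : l1 (0 : Site 4) = 0 := by simp [l1]
      rw [e, mul_zero, Real.exp_zero, mul_one] at h
      exact (tsum_nonneg fun p => Finset.sum_nonneg fun g _ => Finset.sum_nonneg fun f _ => by positivity).trans h
    obtain ⟨kG, K, c, hc, hkG, hK, hrows⟩ := exists_rows_RkSand_on (𝒱 := 𝒱) (𝒲 := 𝒲) (μ := μ) (ν := ν) ha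
      (fun m : ℕ =>
        (∀ (ρ : Fin 4) (y : Site 4), Summable fun p : Site 4 × Site 4 => ∑ g, ∑ f, |ffV (𝒱 (m + 1)) ρ y p.1 p.2 g f|
          * Real.exp (σV / ((m + 1 : ℕ) : ℝ) * (l1 (p.1 - ((m + 1 : ℕ) : ℤ) • y) + l1 (p.2 - ((m + 1 : ℕ) : ℤ) • y)))) ∧
        (∀ (ρ : Fin 4) (y : Site 4), ∑' p : Site 4 × Site 4, ∑ g, ∑ f, |ffV (𝒱 (m + 1)) ρ y p.1 p.2 g f|
          * Real.exp (σV / ((m + 1 : ℕ) : ℝ) * (l1 (p.1 - ((m + 1 : ℕ) : ℤ) • y) + l1 (p.2 - ((m + 1 : ℕ) : ℤ) • y))) ≤ mV) ∧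
        (∀ (z : Site 4), Summable fun p : Site 4 × Site 4 => ∑ g, ∑ f, |ffW (𝒲 (m + 1)) μ 0 ν z p.1 p.2 g f|) ∧
        (∀ (z : Site 4), ∑' p : Site 4 × Site 4, ∑ g, ∑ f, |ffW (𝒲 (m + 1)) μ 0 ν z p.1 p.2 g f| ≤ mW * Real.exp (-κ * l1 z)))
      h12 h126 hσV hmV hκ hmW (fun m hm => hm.1) (fun m hm => hm.2.1) (fun m hm => hm.2.2.1) (fun m hm => hm.2.2.2)
    exact ⟨kG, K, c, hc, hkG, hK, fun m a1 a2 a3 a4 u => hrows u m ⟨a1, a2, a3, a4⟩⟩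
  · exact ⟨0, 0, 1, one_pos, le_rfl, le_rfl, fun m a1 a2 a3 a4 => absurd ⟨m, a1, a2, a3, a4⟩ hex⟩

/-- [folklore] **THE SANDWICH LANE's END SHAPES ON THE END's SUBSEQUENCE** (`RoadEndBFxDictPointwiseS.hdict_of_pointwise` ∕ PART 11 ∕ 14 at
`υ := Unit ⊕ (Bool × Bool)`, `Rk := RkSand a 𝒱 𝒲`): from the ff jet letters AT THE BLOCK SIZES `Lc^k`, `k ≥ 1`, ONLY — ONE n-free `kG, K ≥ 0`, `c > 0` with
(i) `hMR`, (ii) READING (b) (`Ru := 0`, `CU′ := CUsand …`), and the unit row, at every `Lc^k`, `k ≥ 1`.  The `hU₁` fragment is `sum_CUsand(_le)` (p324769). -/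
theorem exists_END_rows_RkSand_pow {Lc : ℕ} [NeZero Lc] (h12 : B5.Prop12Printed (fam nOf hn1 MOf a ha))
    (h126 : B5.Kernel126_127Printed (kfam nOf MOf)) (hσV : 0 < σV)
    (hVs : ∀ (k : ℕ), 1 ≤ k → ∀ (ρ : Fin 4) (y : Site 4), Summable fun p : Site 4 × Site 4 => ∑ g, ∑ f, |ffV (𝒱 (Lc ^ k)) ρ y p.1 p.2 g f|
      * Real.exp (σV / ((Lc ^ k : ℕ) : ℝ) * (l1 (p.1 - ((Lc ^ k : ℕ) : ℤ) • y) + l1 (p.2 - ((Lc ^ k : ℕ) : ℤ) • y))))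
    (hVm : ∀ (k : ℕ), 1 ≤ k → ∀ (ρ : Fin 4) (y : Site 4), ∑' p : Site 4 × Site 4, ∑ g, ∑ f, |ffV (𝒱 (Lc ^ k)) ρ y p.1 p.2 g f|
      * Real.exp (σV / ((Lc ^ k : ℕ) : ℝ) * (l1 (p.1 - ((Lc ^ k : ℕ) : ℤ) • y) + l1 (p.2 - ((Lc ^ k : ℕ) : ℤ) • y))) ≤ mV)
    (hκ : 0 < κ)
    (hWs : ∀ (k : ℕ), 1 ≤ k → ∀ (z : Site 4), Summable fun p : Site 4 × Site 4 => ∑ g, ∑ f, |ffW (𝒲 (Lc ^ k)) μ 0 ν z p.1 p.2 g f|)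
    (hWm : ∀ (k : ℕ), 1 ≤ k → ∀ (z : Site 4),
      ∑' p : Site 4 × Site 4, ∑ g, ∑ f, |ffW (𝒲 (Lc ^ k)) μ 0 ν z p.1 p.2 g f| ≤ mW * Real.exp (-κ * l1 z)) :
    ∃ kG K c : ℝ, 0 < c ∧ 0 ≤ kG ∧ 0 ≤ K ∧
      -- (i) `hMR`
      (∀ (u : Unit ⊕ (Bool × Bool)) (k : ℕ), 1 ≤ k → AbsMoment₂ (RkSand a 𝒱 𝒲 u (Lc ^ k) μ ν)) ∧
      -- (ii) READING (b): `hRu` with `Ru := 0`, `CU′ := CUsand …`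
      (∀ (u : Unit ⊕ (Bool × Bool)) (k : ℕ), 1 ≤ k →
        |B12Beta.secondMoment (RkSand a 𝒱 𝒲 u (Lc ^ k)) μ ν - (fun (_ : Unit ⊕ (Bool × Bool)) (_ : ℕ) => (0 : ℝ)) u (Lc ^ k)|
          ≤ CUsand kG K c σV mV κ mW u) ∧
      -- the unit row on the subsequence
      (∀ (u : Unit ⊕ (Bool × Bool)) (k : ℕ), 1 ≤ k → |B12Beta.secondMoment (RkSand a 𝒱 𝒲 u (Lc ^ k)) μ ν| ≤ CUsand kG K c σV mV κ mW u) := by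
  have hmV : 0 ≤ mV :=
    (tsum_nonneg fun p => Finset.sum_nonneg fun g _ => Finset.sum_nonneg fun f _ => by positivity).trans (hVm 1 le_rfl 0 0)
  have hmW : 0 ≤ mW := by
    have h := hWm 1 le_rfl 0
    have e : l1 (0 : Site 4) = 0 := by simp [l1]
    rw [e, mul_zero, Real.exp_zero, mul_one] at h
    exact (tsum_nonneg fun p => Finset.sum_nonneg fun g _ => Finset.sum_nonneg fun f _ => by positivity).trans h
  have hsc : ∀ k : ℕ, ∃ m : ℕ, m + 1 = Lc ^ k := fun k =>
    ⟨Lc ^ k - 1, Nat.sub_add_cancel (Nat.one_le_pow _ _ (Nat.pos_of_ne_zero (NeZero.ne Lc)))⟩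
  have key := exists_rows_RkSand_on (𝒱 := 𝒱) (𝒲 := 𝒲) (μ := μ) (ν := ν) ha (fun m : ℕ => ∃ k : ℕ, 1 ≤ k ∧ m + 1 = Lc ^ k)
    h12 h126 hσV hmV hκ hmW ?_ ?_ ?_ ?_
  · obtain ⟨kG, K, c, hc, hkG, hK, hrows⟩ := key
    refine ⟨kG, K, c, hc, hkG, hK, fun u k hk => ?_, fun u k hk => ?_, fun u k hk => ?_⟩
    · obtain ⟨m, hm⟩ := hsc k
      rw [← hm]
      exact (hrows u m ⟨k, hk, hm⟩).1
    · obtain ⟨m, hm⟩ := hsc k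
      rw [sub_zero, ← hm]
      exact (hrows u m ⟨k, hk, hm⟩).2
    · obtain ⟨m, hm⟩ := hsc k
      rw [← hm]
      exact (hrows u m ⟨k, hk, hm⟩).2
  · rintro m ⟨k, hk, hm⟩ ρ y
    have h := hVs k hk ρ y
    rw [← hm] at h
    exact h
  · rintro m ⟨k, hk, hm⟩ ρ y
    have h := hVm k hk ρ y
    rw [← hm] at h
    exact h
  · rintro m ⟨k, hk, hm⟩ z
    have h := hWs k hk z
    rw [← hm] at h
    exact h
  · rintro m ⟨k, hk, hm⟩ z
    have h := hWm k hk z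
    rw [← hm] at h
    exact h

end Sand

/-! ## §2 The block pack: letters on a set of scales; per scale; on the subsequence -/

section Blk

variable {a : ℝ} (ha : 0 < a) {𝒱 : ℕ → Fin 4 → Site 4 → MKer 4 (Fib 3)} {𝒲 : ℕ → Fin 4 → Site 4 → Fin 4 → Site 4 → MKer 4 (Fib 3)}
  {σV κ : ℝ} {mV mW : Bool → Bool → ℝ} {μ ν : Fin 4}
include ha

/-- [folklore] **THE BLOCK PACK's ROWS ON A SET OF SCALES** (`P : ℕ → Prop`; blockwise letters at every `m` with `P m`; `0 ≤ mV j k`, `0 ≤ mW j i` displayed):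
ONE n-free `kG, K ≥ 0`, `c > 0` and the rows of every member at every such block size `m + 1` (mod [B5] BY NAME). -/
theorem exists_rows_RkBlk_on (P : ℕ → Prop) (h12 : B5.Prop12Printed (fam nOf hn1 MOf a ha)) (h126 : B5.Kernel126_127Printed (kfam nOf MOf))
    (hσV : 0 < σV) (hmV : ∀ j k, 0 ≤ mV j k) (hκ : 0 < κ) (hmW : ∀ j i, 0 ≤ mW j i)
    (hVs : ∀ (m : ℕ), P m → ∀ (ρ : Fin 4) (y : Site 4) (j k : Bool), Summable fun p : Site 4 × Site 4 =>
      ∑ g, ∑ f, |blk (𝒱 (m + 1) ρ y) j k p.1 p.2 g f|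
        * Real.exp (σV / ((m + 1 : ℕ) : ℝ) * (l1 (p.1 - ((m + 1 : ℕ) : ℤ) • y) + l1 (p.2 - ((m + 1 : ℕ) : ℤ) • y))))
    (hVm : ∀ (m : ℕ), P m → ∀ (ρ : Fin 4) (y : Site 4) (j k : Bool), ∑' p : Site 4 × Site 4, ∑ g, ∑ f, |blk (𝒱 (m + 1) ρ y) j k p.1 p.2 g f|
      * Real.exp (σV / ((m + 1 : ℕ) : ℝ) * (l1 (p.1 - ((m + 1 : ℕ) : ℤ) • y) + l1 (p.2 - ((m + 1 : ℕ) : ℤ) • y))) ≤ mV j k)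
    (hWs : ∀ (m : ℕ), P m → ∀ (z : Site 4) (j i : Bool),
      Summable fun p : Site 4 × Site 4 => ∑ g, ∑ f, |blk (𝒲 (m + 1) μ 0 ν z) j i p.1 p.2 g f|)
    (hWm : ∀ (m : ℕ), P m → ∀ (z : Site 4) (j i : Bool), ∑' p : Site 4 × Site 4, ∑ g, ∑ f, |blk (𝒲 (m + 1) μ 0 ν z) j i p.1 p.2 g f|
      ≤ mW j i * Real.exp (-κ * l1 z)) :
    ∃ kG K c : ℝ, 0 < c ∧ 0 ≤ kG ∧ 0 ≤ K ∧ ∀ (u : (Bool × Bool) ⊕ (Bool × Bool × Bool × Bool)) (m : ℕ), P m →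
      AbsMoment₂ (RkBlk a 𝒱 𝒲 u (m + 1) μ ν) ∧ |B12Beta.secondMoment (RkBlk a 𝒱 𝒲 u (m + 1)) μ ν| ≤ CUblk kG K c σV mV κ mW u := by
  classical
  have key := exists_rows_RkBlk (𝒱 := fun n => if P (n - 1) then 𝒱 n else 0) (𝒲 := fun n => if P (n - 1) then 𝒲 n else 0)
    (mV := mV) (mW := mW) (μ := μ) (ν := ν) ha h12 h126 hσV ?_ ?_ hκ ?_ ?_
  · obtain ⟨kG, K, c, hc, hkG, hK, hrows⟩ := key
    refine ⟨kG, K, c, hc, hkG, hK, fun u m hm => ?_⟩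
    rw [← RkBlk_congr a (𝒱 := 𝒱) (𝒲 := 𝒲) (𝒱' := fun n => if P (n - 1) then 𝒱 n else 0) (𝒲' := fun n => if P (n - 1) then 𝒲 n else 0)
      (show (if P (m + 1 - 1) then 𝒱 (m + 1) else 0) = 𝒱 (m + 1) by rw [Nat.add_sub_cancel, if_pos hm])
      (show (if P (m + 1 - 1) then 𝒲 (m + 1) else 0) = 𝒲 (m + 1) by rw [Nat.add_sub_cancel, if_pos hm]) u]
    exact hrows u (m + 1) (Nat.succ_le_succ (Nat.zero_le m))
  · intro m ρ y j k
    by_cases hm : P m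
    · simp only [Nat.add_sub_cancel, if_pos hm]
      exact hVs m hm ρ y j k
    · simp only [Nat.add_sub_cancel, if_neg hm, Pi.zero_apply]
      rw [mass_zero_integrand (fun x z g f => blk_zero_apply₂ j k x z g f)]
      exact summable_zero
  · intro m ρ y j k
    by_cases hm : P m
    · simp only [Nat.add_sub_cancel, if_pos hm]
      exact hVm m hm ρ y j k
    · simp only [Nat.add_sub_cancel, if_neg hm, Pi.zero_apply]
      rw [mass_zero_integrand (fun x z g f => blk_zero_apply₂ j k x z g f), tsum_zero]
      exact hmV j k
  · intro m z j i
    by_cases hm : P m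
    · simp only [Nat.add_sub_cancel, if_pos hm]
      exact hWs m hm z j i
    · simp only [Nat.add_sub_cancel, if_neg hm, Pi.zero_apply]
      have e := mass_zero_integrand (fun x z' g f => blk_zero_apply₂ j i x z' g f) (fun _ => (1 : ℝ))
      simp only [mul_one] at e
      rw [e]
      exact summable_zero
  · intro m z j i
    by_cases hm : P m
    · simp only [Nat.add_sub_cancel, if_pos hm]
      exact hWm m hm z j i
    · simp only [Nat.add_sub_cancel, if_neg hm, Pi.zero_apply]
      have e := mass_zero_integrand (fun x z' g f => blk_zero_apply₂ j i x z' g f) (fun _ => (1 : ℝ))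
      simp only [mul_one] at e
      rw [e, tsum_zero]
      exact mul_nonneg (hmW j i) (Real.exp_pos _).le

/-- [folklore] **THE BLOCK PACK's ROWS, PER SCALE** (OWNER W-11's primitive): ONE n-free `kG, K ≥ 0`, `c > 0` such that AT EVERY `m` the four blockwise
letters AT THIS `m` imply the rows of every member at block size `m + 1`; no nonnegativity displayed. -/
theorem exists_rows_RkBlk_at (h12 : B5.Prop12Printed (fam nOf hn1 MOf a ha)) (h126 : B5.Kernel126_127Printed (kfam nOf MOf))
    (hσV : 0 < σV) (hκ : 0 < κ) :
    ∃ kG K c : ℝ, 0 < c ∧ 0 ≤ kG ∧ 0 ≤ K ∧ ∀ (m : ℕ),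
      (∀ (ρ : Fin 4) (y : Site 4) (j k : Bool), Summable fun p : Site 4 × Site 4 => ∑ g, ∑ f, |blk (𝒱 (m + 1) ρ y) j k p.1 p.2 g f|
        * Real.exp (σV / ((m + 1 : ℕ) : ℝ) * (l1 (p.1 - ((m + 1 : ℕ) : ℤ) • y) + l1 (p.2 - ((m + 1 : ℕ) : ℤ) • y)))) →
      (∀ (ρ : Fin 4) (y : Site 4) (j k : Bool), ∑' p : Site 4 × Site 4, ∑ g, ∑ f, |blk (𝒱 (m + 1) ρ y) j k p.1 p.2 g f|
        * Real.exp (σV / ((m + 1 : ℕ) : ℝ) * (l1 (p.1 - ((m + 1 : ℕ) : ℤ) • y) + l1 (p.2 - ((m + 1 : ℕ) : ℤ) • y))) ≤ mV j k) →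
      (∀ (z : Site 4) (j i : Bool), Summable fun p : Site 4 × Site 4 => ∑ g, ∑ f, |blk (𝒲 (m + 1) μ 0 ν z) j i p.1 p.2 g f|) →
      (∀ (z : Site 4) (j i : Bool), ∑' p : Site 4 × Site 4, ∑ g, ∑ f, |blk (𝒲 (m + 1) μ 0 ν z) j i p.1 p.2 g f|
        ≤ mW j i * Real.exp (-κ * l1 z)) →
      ∀ (u : (Bool × Bool) ⊕ (Bool × Bool × Bool × Bool)),
        AbsMoment₂ (RkBlk a 𝒱 𝒲 u (m + 1) μ ν) ∧ |B12Beta.secondMoment (RkBlk a 𝒱 𝒲 u (m + 1)) μ ν| ≤ CUblk kG K c σV mV κ mW u := by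
  by_cases hex : ∃ m : ℕ,
      (∀ (ρ : Fin 4) (y : Site 4) (j k : Bool), Summable fun p : Site 4 × Site 4 => ∑ g, ∑ f, |blk (𝒱 (m + 1) ρ y) j k p.1 p.2 g f|
        * Real.exp (σV / ((m + 1 : ℕ) : ℝ) * (l1 (p.1 - ((m + 1 : ℕ) : ℤ) • y) + l1 (p.2 - ((m + 1 : ℕ) : ℤ) • y)))) ∧
      (∀ (ρ : Fin 4) (y : Site 4) (j k : Bool), ∑' p : Site 4 × Site 4, ∑ g, ∑ f, |blk (𝒱 (m + 1) ρ y) j k p.1 p.2 g f|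
        * Real.exp (σV / ((m + 1 : ℕ) : ℝ) * (l1 (p.1 - ((m + 1 : ℕ) : ℤ) • y) + l1 (p.2 - ((m + 1 : ℕ) : ℤ) • y))) ≤ mV j k) ∧
      (∀ (z : Site 4) (j i : Bool), Summable fun p : Site 4 × Site 4 => ∑ g, ∑ f, |blk (𝒲 (m + 1) μ 0 ν z) j i p.1 p.2 g f|) ∧
      (∀ (z : Site 4) (j i : Bool), ∑' p : Site 4 × Site 4, ∑ g, ∑ f, |blk (𝒲 (m + 1) μ 0 ν z) j i p.1 p.2 g f|
        ≤ mW j i * Real.exp (-κ * l1 z))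
  · obtain ⟨m₀, h1, h2, -, h4⟩ := hex
    have hmV : ∀ j k, 0 ≤ mV j k := fun j k =>
      (tsum_nonneg fun p => Finset.sum_nonneg fun g _ => Finset.sum_nonneg fun f _ => by positivity).trans (h2 0 0 j k)
    have hmW : ∀ j i, 0 ≤ mW j i := fun j i => by
      have h := h4 0 j i
      have e : l1 (0 : Site 4) = 0 := by simp [l1]
      rw [e, mul_zero, Real.exp_zero, mul_one] at h
      exact (tsum_nonneg fun p => Finset.sum_nonneg fun g _ => Finset.sum_nonneg fun f _ => by positivity).trans h
    obtain ⟨kG, K, c, hc, hkG, hK, hrows⟩ := exists_rows_RkBlk_on (𝒱 := 𝒱) (𝒲 := 𝒲) (μ := μ) (ν := ν) ha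
      (fun m : ℕ =>
        (∀ (ρ : Fin 4) (y : Site 4) (j k : Bool), Summable fun p : Site 4 × Site 4 => ∑ g, ∑ f, |blk (𝒱 (m + 1) ρ y) j k p.1 p.2 g f|
          * Real.exp (σV / ((m + 1 : ℕ) : ℝ) * (l1 (p.1 - ((m + 1 : ℕ) : ℤ) • y) + l1 (p.2 - ((m + 1 : ℕ) : ℤ) • y)))) ∧
        (∀ (ρ : Fin 4) (y : Site 4) (j k : Bool), ∑' p : Site 4 × Site 4, ∑ g, ∑ f, |blk (𝒱 (m + 1) ρ y) j k p.1 p.2 g f|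
          * Real.exp (σV / ((m + 1 : ℕ) : ℝ) * (l1 (p.1 - ((m + 1 : ℕ) : ℤ) • y) + l1 (p.2 - ((m + 1 : ℕ) : ℤ) • y))) ≤ mV j k) ∧
        (∀ (z : Site 4) (j i : Bool), Summable fun p : Site 4 × Site 4 => ∑ g, ∑ f, |blk (𝒲 (m + 1) μ 0 ν z) j i p.1 p.2 g f|) ∧
        (∀ (z : Site 4) (j i : Bool), ∑' p : Site 4 × Site 4, ∑ g, ∑ f, |blk (𝒲 (m + 1) μ 0 ν z) j i p.1 p.2 g f|
          ≤ mW j i * Real.exp (-κ * l1 z)))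
      h12 h126 hσV hmV hκ hmW (fun m hm => hm.1) (fun m hm => hm.2.1) (fun m hm => hm.2.2.1) (fun m hm => hm.2.2.2)
    exact ⟨kG, K, c, hc, hkG, hK, fun m a1 a2 a3 a4 u => hrows u m ⟨a1, a2, a3, a4⟩⟩
  · exact ⟨0, 0, 1, one_pos, le_rfl, le_rfl, fun m a1 a2 a3 a4 => absurd ⟨m, a1, a2, a3, a4⟩ hex⟩

/-- [folklore] **THE BLOCK LANE's END SHAPES ON THE END's SUBSEQUENCE** (`υ := (Bool × Bool) ⊕ (Bool × Bool × Bool × Bool)`, `Rk := RkBlk a 𝒱 𝒲`): from the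
blockwise letters AT THE BLOCK SIZES `Lc^k`, `k ≥ 1`, ONLY — ONE n-free `kG, K ≥ 0`, `c > 0` with (i) `hMR`, (ii) READING (b) (`Ru := 0`, `CU′ := CUblk …`) and the
unit row at every `Lc^k`, `k ≥ 1`.  The `hU₁` fragment is `sum_CUblk(_le)` (p325854). -/
theorem exists_END_rows_RkBlk_pow {Lc : ℕ} [NeZero Lc] (h12 : B5.Prop12Printed (fam nOf hn1 MOf a ha))
    (h126 : B5.Kernel126_127Printed (kfam nOf MOf)) (hσV : 0 < σV)
    (hVs : ∀ (k : ℕ), 1 ≤ k → ∀ (ρ : Fin 4) (y : Site 4) (j k' : Bool), Summable fun p : Site 4 × Site 4 =>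
      ∑ g, ∑ f, |blk (𝒱 (Lc ^ k) ρ y) j k' p.1 p.2 g f|
        * Real.exp (σV / ((Lc ^ k : ℕ) : ℝ) * (l1 (p.1 - ((Lc ^ k : ℕ) : ℤ) • y) + l1 (p.2 - ((Lc ^ k : ℕ) : ℤ) • y))))
    (hVm : ∀ (k : ℕ), 1 ≤ k → ∀ (ρ : Fin 4) (y : Site 4) (j k' : Bool), ∑' p : Site 4 × Site 4, ∑ g, ∑ f, |blk (𝒱 (Lc ^ k) ρ y) j k' p.1 p.2 g f|
      * Real.exp (σV / ((Lc ^ k : ℕ) : ℝ) * (l1 (p.1 - ((Lc ^ k : ℕ) : ℤ) • y) + l1 (p.2 - ((Lc ^ k : ℕ) : ℤ) • y))) ≤ mV j k')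
    (hκ : 0 < κ)
    (hWs : ∀ (k : ℕ), 1 ≤ k → ∀ (z : Site 4) (j i : Bool),
      Summable fun p : Site 4 × Site 4 => ∑ g, ∑ f, |blk (𝒲 (Lc ^ k) μ 0 ν z) j i p.1 p.2 g f|)
    (hWm : ∀ (k : ℕ), 1 ≤ k → ∀ (z : Site 4) (j i : Bool), ∑' p : Site 4 × Site 4, ∑ g, ∑ f, |blk (𝒲 (Lc ^ k) μ 0 ν z) j i p.1 p.2 g f|
      ≤ mW j i * Real.exp (-κ * l1 z)) :
    ∃ kG K c : ℝ, 0 < c ∧ 0 ≤ kG ∧ 0 ≤ K ∧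
      -- (i) `hMR`
      (∀ (u : (Bool × Bool) ⊕ (Bool × Bool × Bool × Bool)) (k : ℕ), 1 ≤ k → AbsMoment₂ (RkBlk a 𝒱 𝒲 u (Lc ^ k) μ ν)) ∧
      -- (ii) READING (b): `hRu` with `Ru := 0`, `CU′ := CUblk …`
      (∀ (u : (Bool × Bool) ⊕ (Bool × Bool × Bool × Bool)) (k : ℕ), 1 ≤ k →
        |B12Beta.secondMoment (RkBlk a 𝒱 𝒲 u (Lc ^ k)) μ ν
          - (fun (_ : (Bool × Bool) ⊕ (Bool × Bool × Bool × Bool)) (_ : ℕ) => (0 : ℝ)) u (Lc ^ k)| ≤ CUblk kG K c σV mV κ mW u) ∧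
      -- the unit row on the subsequence
      (∀ (u : (Bool × Bool) ⊕ (Bool × Bool × Bool × Bool)) (k : ℕ), 1 ≤ k →
        |B12Beta.secondMoment (RkBlk a 𝒱 𝒲 u (Lc ^ k)) μ ν| ≤ CUblk kG K c σV mV κ mW u) := by
  have hmV : ∀ j k', 0 ≤ mV j k' := fun j k' =>
    (tsum_nonneg fun p => Finset.sum_nonneg fun g _ => Finset.sum_nonneg fun f _ => by positivity).trans (hVm 1 le_rfl 0 0 j k')
  have hmW : ∀ j i, 0 ≤ mW j i := fun j i => by
    have h := hWm 1 le_rfl 0 j i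
    have e : l1 (0 : Site 4) = 0 := by simp [l1]
    rw [e, mul_zero, Real.exp_zero, mul_one] at h
    exact (tsum_nonneg fun p => Finset.sum_nonneg fun g _ => Finset.sum_nonneg fun f _ => by positivity).trans h
  have hsc : ∀ k : ℕ, ∃ m : ℕ, m + 1 = Lc ^ k := fun k =>
    ⟨Lc ^ k - 1, Nat.sub_add_cancel (Nat.one_le_pow _ _ (Nat.pos_of_ne_zero (NeZero.ne Lc)))⟩
  have key := exists_rows_RkBlk_on (𝒱 := 𝒱) (𝒲 := 𝒲) (μ := μ) (ν := ν) ha (fun m : ℕ => ∃ k : ℕ, 1 ≤ k ∧ m + 1 = Lc ^ k)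
    h12 h126 hσV hmV hκ hmW ?_ ?_ ?_ ?_
  · obtain ⟨kG, K, c, hc, hkG, hK, hrows⟩ := key
    refine ⟨kG, K, c, hc, hkG, hK, fun u k hk => ?_, fun u k hk => ?_, fun u k hk => ?_⟩
    · obtain ⟨m, hm⟩ := hsc k
      rw [← hm]
      exact (hrows u m ⟨k, hk, hm⟩).1
    · obtain ⟨m, hm⟩ := hsc k
      rw [sub_zero, ← hm]
      exact (hrows u m ⟨k, hk, hm⟩).2
    · obtain ⟨m, hm⟩ := hsc k
      rw [← hm]
      exact (hrows u m ⟨k, hk, hm⟩).2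
  · rintro m ⟨k, hk, hm⟩ ρ y j k'
    have h := hVs k hk ρ y j k'
    rw [← hm] at h
    exact h
  · rintro m ⟨k, hk, hm⟩ ρ y j k'
    have h := hVm k hk ρ y j k'
    rw [← hm] at h
    exact h
  · rintro m ⟨k, hk, hm⟩ z j i
    have h := hWs k hk z j i
    rw [← hm] at h
    exact h
  · rintro m ⟨k, hk, hm⟩ z j i
    have h := hWm k hk z j i
    rw [← hm] at h
    exact h

end Blk

end Summit.QuantumFields.BalabanUV.Beta.D1BFx.RestKernelSlotRowsOn

end
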